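import Summits.CriticalPhenomena.PercolationContinuityZ3.Theorems.PercNearOneGluingNoHeavyLowerTailSahiHittingDepthTwoFive
import HarnessLib

/-!
# `NoHeavyLowerTail` (stmt-CriticalPhenomena-4575) — two-variable Bernstein SLICING of a 15-variable term list (for the order-6 pair-type certificate)

Support file, seat `prim-l12-p5` (gen 9), `--supports stmt-CriticalPhenomena-4575`.  Standard axioms; definitions are data tables and two list
operations; no sorries.  First of five files proving Sahi's `C₆` for PAIR-TYPE hitting families (six sets of a product space, every coin in exactly two of
them): the universal order-6 hitting polynomial restricted to the 15 pair regions `r_e` (`e` ⊂ {0,…,5}, `|e| = 2`, ordered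
`01,02,03,04,05,12,13,14,15,23,24,25,34,35,45` = `r 0,…,r 14`) has `864` integer terms (coefficients in `[−456, 72]`, degree 2 in each variable; seat
engine `code/upoly.py`, Sahi's set-partition form over the 203 partitions with the inclusion–exclusion hitting moments), and ALL its `3¹⁵ = 14 348 907`
tensor-Bernstein coefficients are `≥ 0` (kit j101758, numpy, two variable orders).  One `native_decide` over that box exceeds the farm's elaboration
window, so the certificate is SLICED: by the one-variable expansion `x^e = Σ_j vfac(2,e,j)·x^j(1−x)^{2−j}` (tree `SparseBernstein.pow_eq_sum_vfac`) in the
two variables `r 0, r 1`,  `P = Σ_{j₀,j₁ ≤ 2} r₀^{j₀}(1−r₀)^{2−j₀} r₁^{j₁}(1−r₁)^{2−j₁} · P_{j₀j₁}`  (`evalLV_slice2_decomp`, any term list of degree ≤ 2 in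
`r 0, r 1`), where `P_{j₀j₁} = slice2 P j₀ j₁` has the exponents of `r 0, r 1` removed; the tensor-Bernstein coefficients of `P` at profile
`(j₀,j₁,j'')` are those of `P_{j₀j₁}` at `j''`, so nine certificates on `3¹³`-boxes (files `…SahiHittingPairSixCertA/B/C`) give `P ≥ 0` on the cube
(`evalLV_nonneg_of_slice2`); the assembly and the theorem are in `…SahiHittingPairSix`.
* (data `p6Data` and its degree bound: `…SahiHittingPairSixData`.)
* `slice2`, `prune` (drop zero coefficients), `evalLV_prune`, `evalLV_slice2_decomp`, `evalLV_nonneg_of_slice2`, `slice_nonneg_of_check`, `sliceDeg`.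
[this work]
-/

namespace Summit.CriticalPhenomena.PercolationContinuityZ3.Theorems

namespace SahiHitting

open Finset SparseBernstein Literature.Combinatorics.Sahi2008

/-! ## Slicing a 15-variable term list along the Bernstein indices of `x 0` and `x 1` -/

/-- Slice `(j₀,j₁)`: coefficient `c·vfac(2,e₀,j₀)·vfac(2,e₁,j₁)`, exponents of `x 0`, `x 1` set to `0`. [this work] -/
def slice2 (L : List (ℤ × (Fin 15 → ℕ))) (j0 j1 : ℕ) : List (ℤ × (Fin 15 → ℕ)) :=
  L.map fun t => (t.1 * vfac 2 (t.2 0) j0 * vfac 2 (t.2 1) j1, Function.update (Function.update t.2 0 0) 1 0)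

/-- Drop the terms with coefficient `0` (for the checker only). [this work] -/
def prune (L : List (ℤ × (Fin 15 → ℕ))) : List (ℤ × (Fin 15 → ℕ)) := L.filter fun t => t.1 ≠ 0

/-- Multidegree of a slice: `0` in `x 0, x 1`, `2` elsewhere. [this work] -/
def sliceDeg : Fin 15 → ℕ := ![0, 0, 2, 2, 2, 2, 2, 2, 2, 2, 2, 2, 2, 2, 2]

/-- Pruning does not change the evaluation. [folklore] -/
theorem evalLV_prune (L : List (ℤ × (Fin 15 → ℕ))) (x : Fin 15 → ℝ) : evalLV (prune L) x = evalLV L x := by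
  induction L with
  | nil => rfl
  | cons t ts ih =>
    simp only [prune, List.filter_cons] at ih ⊢
    by_cases h : t.1 ≠ 0
    · simp only [h, ne_eq, not_false_eq_true, decide_true, ↓reduceIte, evalLV, ih]
    · have h0 : t.1 = 0 := not_not.mp h
      simp only [h0, ne_eq, not_true_eq_false, decide_false, Bool.false_eq_true, ↓reduceIte, evalLV, ih, Int.cast_zero,
        zero_mul, zero_add]

/-- One term: `c·∏ x_i^{e_i} = Σ_{j₀,j₁<3} B_{j₀}(x₀)B_{j₁}(x₁)·(c·vfac·vfac)·∏ x_i^{e''_i}` (`e''` = `e` with `e₀ = e₁ = 0`). [folklore] -/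
theorem term_slice2_decomp (c : ℤ) (e : Fin 15 → ℕ) (he0 : e 0 ≤ 2) (he1 : e 1 ≤ 2) (x : Fin 15 → ℝ) :
    (c : ℝ) * ∏ i, x i ^ e i = ∑ j0 ∈ Finset.range 3, ∑ j1 ∈ Finset.range 3,
      (x 0 ^ j0 * (1 - x 0) ^ (2 - j0)) * (x 1 ^ j1 * (1 - x 1) ^ (2 - j1)) *
        (((c * vfac 2 (e 0) j0 * vfac 2 (e 1) j1 : ℤ) : ℝ) * ∏ i, x i ^ (Function.update (Function.update e 0 0) 1 0) i) := by
  have P1 : ∏ i, x i ^ e i = x 0 ^ e 0 * (x 1 ^ e 1 * ∏ i : Fin 13, x i.succ.succ ^ e i.succ.succ) := by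
    rw [Fin.prod_univ_succ, Fin.prod_univ_succ]
    simp only [Fin.succ_zero_eq_one]
  have P2 : ∏ i, x i ^ (Function.update (Function.update e 0 0) 1 0) i = ∏ i : Fin 13, x i.succ.succ ^ e i.succ.succ := by
    rw [Fin.prod_univ_succ, Fin.prod_univ_succ]
    have h10 : (1 : Fin 15) ≠ 0 := by decide
    have hs0 : ∀ i : Fin 13, i.succ.succ ≠ (0 : Fin 15) := fun i => Fin.succ_ne_zero _
    have hs1 : ∀ i : Fin 13, i.succ.succ ≠ (1 : Fin 15) := fun i h => by
      have : i.succ = 0 := Fin.succ_injective _ (by rw [h]; rfl)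
      exact Fin.succ_ne_zero _ this
    simp only [Function.update_self, Function.update_of_ne h10.symm, Function.update_of_ne (hs1 _), Function.update_of_ne (hs0 _),
      pow_zero, one_mul, Fin.succ_zero_eq_one]
  rw [P1, P2, pow_eq_sum_vfac (x 0) he0, pow_eq_sum_vfac (x 1) he1, Finset.sum_mul, Finset.mul_sum]
  refine Finset.sum_congr rfl fun j0 _ => ?_
  rw [Finset.sum_mul, Finset.mul_sum, Finset.mul_sum]
  refine Finset.sum_congr rfl fun j1 _ => ?_
  push_cast
  ring

/-- **Two-variable Bernstein decomposition of a term list** (degree ≤ 2 in `x 0, x 1`). [this work] -/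
theorem evalLV_slice2_decomp (L : List (ℤ × (Fin 15 → ℕ))) (hL : ∀ t ∈ L, t.2 0 ≤ 2 ∧ t.2 1 ≤ 2) (x : Fin 15 → ℝ) :
    evalLV L x = ∑ j0 ∈ Finset.range 3, ∑ j1 ∈ Finset.range 3,
      (x 0 ^ j0 * (1 - x 0) ^ (2 - j0)) * (x 1 ^ j1 * (1 - x 1) ^ (2 - j1)) * evalLV (slice2 L j0 j1) x := by
  induction L with
  | nil => simp [evalLV, slice2]
  | cons t ts ih =>
    have ht := hL t (by simp)
    have ih' := ih (fun t' h => hL t' (by simp [h]))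
    have hcons : ∀ j0 j1, slice2 (t :: ts) j0 j1 =
        (t.1 * vfac 2 (t.2 0) j0 * vfac 2 (t.2 1) j1, Function.update (Function.update t.2 0 0) 1 0) :: slice2 ts j0 j1 :=
      fun j0 j1 => rfl
    simp only [hcons, evalLV]
    rw [ih', term_slice2_decomp t.1 t.2 ht.1 ht.2 x, ← Finset.sum_add_distrib]
    refine Finset.sum_congr rfl fun j0 _ => ?_
    rw [← Finset.sum_add_distrib]
    refine Finset.sum_congr rfl fun j1 _ => ?_
    ring

/-- **Positivity from the nine slices.** [this work] -/
theorem evalLV_nonneg_of_slice2 (L : List (ℤ × (Fin 15 → ℕ))) (hL : ∀ t ∈ L, t.2 0 ≤ 2 ∧ t.2 1 ≤ 2) {x : Fin 15 → ℝ}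
    (hx : ∀ i, 0 ≤ x i ∧ x i ≤ 1) (hs : ∀ j0 ∈ Finset.range 3, ∀ j1 ∈ Finset.range 3, 0 ≤ evalLV (slice2 L j0 j1) x) :
    0 ≤ evalLV L x := by
  rw [evalLV_slice2_decomp L hL x]
  refine Finset.sum_nonneg fun j0 hj0 => Finset.sum_nonneg fun j1 hj1 => ?_
  have h0 := hx 0
  have h1 := hx 1
  exact mul_nonneg (mul_nonneg (mul_nonneg (pow_nonneg h0.1 _) (pow_nonneg (by linarith) _))
    (mul_nonneg (pow_nonneg h1.1 _) (pow_nonneg (by linarith) _))) (hs j0 hj0 j1 hj1)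

/-- A pruned slice certified by `check` is nonnegative on the cube. [this work] -/
theorem slice_nonneg_of_check (L : List (ℤ × (Fin 15 → ℕ))) (j0 j1 : ℕ)
    (hdeg : ∀ j i, (tableOfList (prune (slice2 L j0 j1)) j).2 i ≤ sliceDeg i)
    (hc : check (tableOfList (prune (slice2 L j0 j1))) sliceDeg = true) {x : Fin 15 → ℝ} (hx : ∀ i, 0 ≤ x i ∧ x i ≤ 1) :
    0 ≤ evalLV (slice2 L j0 j1) x := by
  rw [← evalLV_prune]
  exact evalLV_nonneg_of_check _ sliceDeg hdeg hc hx

/-- Degree bound of every pruned slice from the degree bound of the list. [this work] -/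
theorem slice_deg (L : List (ℤ × (Fin 15 → ℕ))) (hL : ∀ t ∈ L, ∀ i, t.2 i ≤ 2) (j0 j1 : ℕ) :
    ∀ j i, (tableOfList (prune (slice2 L j0 j1)) j).2 i ≤ sliceDeg i := by
  intro j i
  have hmem : tableOfList (prune (slice2 L j0 j1)) j ∈ prune (slice2 L j0 j1) := List.get_mem _ _
  have hmem' : tableOfList (prune (slice2 L j0 j1)) j ∈ slice2 L j0 j1 := List.mem_of_mem_filter hmem
  obtain ⟨t, htL, ht⟩ := List.mem_map.1 hmem'
  rw [← ht]
  have h10 : (1 : Fin 15) ≠ 0 := by decide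
  dsimp only
  refine Fin.cases ?_ (fun i1 => ?_) i
  · simp [sliceDeg]
  · refine Fin.cases ?_ (fun i2 => ?_) i1
    · simp [sliceDeg]
    · have hs0 : i2.succ.succ ≠ (0 : Fin 15) := Fin.succ_ne_zero _
      have hs1 : i2.succ.succ ≠ (1 : Fin 15) := fun h => by
        have : i2.succ = 0 := Fin.succ_injective _ (by rw [h]; rfl)
        exact Fin.succ_ne_zero _ this
      rw [Function.update_of_ne hs1, Function.update_of_ne hs0]
      have := hL t htL i2.succ.succ
      have hd : sliceDeg i2.succ.succ = 2 := by
        fin_cases i2 <;> rfl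
      rw [hd]; exact this

end SahiHitting

end Summit.CriticalPhenomena.PercolationContinuityZ3.Theorems
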